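import Summits.KontsevichZagierPeriods.KontsevichZagierPeriods.Theses.SphericalSchlafli
import Summits.KontsevichZagierPeriods.KontsevichZagierPeriods.Theorems.InverseLandauTateLiftingRadialBand
import Summits.KontsevichZagierPeriods.KontsevichZagierPeriods.Theorems.HyperbolicBlochOffTetraSectorKernelRedAux
import Literature.NumberTheory.Transcendental.GammaMonomialsProofs
import Literature.NumberTheory.Transcendental.KZSemialgebraicComplex
import Literature.NumberTheory.Transcendental.SemialgebraicLineDeriv
import Literature.NumberTheory.Transcendental.KZIntervalPeriodProofs

/-!
# `KRSectorExists` (stmt-KontsevichZagierPeriods-3821, route SphericalSchlafli) — proof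

The item asks for (i) four vectors `n₀, …, n₃ ∈ ℝ⁴` whose Gram matrix is the Kolpakov–Robins matrix
`G = !![1, −cos(13π/18), −cos(5π/18), −cos(2π/9); …]` (entries `G_ij = −cos θ_ij` for the dihedral
angles `(5π/18, 2π/9, 13π/18, 11π/18)` of their `ℤ₂`-symmetric rational spherical tetrahedron `T`),
and (ii) an integral representation of the Kontsevich–Zagier calculus with integrand `1` on the solid
sector `{v ∈ B⁴ | ⟨nᵢ, v⟩ ≥ 0}`.

Proof.
* With `A = cos(5π/18) = sin 40°`, `C = cos(2π/9) = cos 40°`, `D = sin(π/9) = sin 20°` the matrix is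
  `G = !![1, A, −A, −C; A, 1, −C, −A; −A, −C, 1, D; −C, −A, D, 1]` (`cos(13π/18) = −A`,
  `cos(11π/18) = −D`). It is invariant under the simultaneous swap `0 ↔ 1`, `2 ↔ 3`, and we realise
  this involution by `(v₀, v₁, v₂, v₃) ↦ (v₀, v₁, −v₂, −v₃)`: the explicit vectors
  `n₀ = (P, 0, Q, 0)`, `n₁ = (P, 0, −Q, 0)`, `n₂ = (X, Z, Y, W)`, `n₃ = (X, Z, −Y, −W)` with
  `P² = (1+a)/2`, `Q² = (1−a)/2`, `PX = (b+c)/2`, `QY = (b−c)/2`, `Z² = (1+d)/2 − X²`,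
  `W² = (1−d)/2 − Y²` have Gram matrix `!![1, a, b, c; a, 1, c, b; b, c, 1, d; c, b, d, 1]` as soon as
  `|a| < 1` and the two radicands are non-negative, i.e. `(b+c)² ≤ (1+a)(1+d)` and
  `(b−c)² ≤ (1−a)(1−d)` (`kr_gram_factor`; this is the positive-semidefiniteness certificate). The
  coordinates are nested square roots of the real-algebraic numbers `cos(kπ/18)`, hence real-algebraic.
* The two margins are NUMERICAL facts (`2.20 ≥ 1.99` and `0.234 ≥ 0.016`); we certify them from
  decimal brackets of `A, C, D` (`kr_trig_bounds`), themselves obtained without any table: `c = cos 20°`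
  is the positive root of `4c³ − 3c = cos 60° = 1/2`, whence `0.9396 < c < 0.9398`, and
  `s = sin 20° = √(1 − c²)`, `C = 2c² − 1`, `A = 2sc`.
* The sector is `ℚ`-semialgebraic because real-algebraic constants are `ℚ`-definable
  (`isSemialgebraicFunOn_const_of_isAlgebraic`, Tarski–Seidenberg in the tree), the integrand `1` is
  a rational constant, and a constant is integrable on a subset of the unit ball.

References: A. Kolpakov, S. Robins, *Spherical tetrahedra with rational volume, and spherical
Pythagorean triples*, Math. Comp. (2019), §2 (the Gram matrix of `T`); M. Kontsevich, D. Zagier,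
*Periods* (2001), §1.1; J. Bochnak, M. Coste, M.-F. Roy, *Real Algebraic Geometry* (1998), §2.2.
-/

noncomputable section

open MeasureTheory Set
open Literature.NumberTheory.Transcendental
open Literature.ModelTheory.ExponentialFields (IsSemialgebraic)

namespace Summit.KontsevichZagierPeriods.SphericalSchlafli

/-- **Decimal brackets for the Kolpakov–Robins cosines.** `cos(5π/18) = sin 40° ∈ (0.6419, 0.6436)`,
`cos(2π/9) = cos 40° ∈ (0.7656, 0.7665)`, `sin(π/9) = sin 20° ∈ (0.3416, 0.3424)`. Proof: `c = cos(π/9)`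
is positive and `4c³ − 3c = cos(π/3) = 1/2` (triple angle), which brackets `c` in `(0.9396, 0.9398)`
(the cubic is monotone there); `s = sin(π/9) > 0`, `s² + c² = 1`; `cos 40° = 2c² − 1`,
`sin 40° = 2sc`. [folklore] -/
theorem kr_trig_bounds :
    (0.6419 < Real.cos (5 * Real.pi / 18) ∧ Real.cos (5 * Real.pi / 18) < 0.6436) ∧
    (0.7656 < Real.cos (2 * Real.pi / 9) ∧ Real.cos (2 * Real.pi / 9) < 0.7665) ∧
    (0.3416 < Real.sin (Real.pi / 9) ∧ Real.sin (Real.pi / 9) < 0.3424) := by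
  obtain ⟨c, hc⟩ : ∃ c, c = Real.cos (Real.pi / 9) := ⟨_, rfl⟩
  obtain ⟨s, hs⟩ : ∃ s, s = Real.sin (Real.pi / 9) := ⟨_, rfl⟩
  have hc3 : 4 * c ^ 3 - 3 * c = 1 / 2 := by
    rw [hc, ← Real.cos_three_mul, ← Real.cos_pi_div_three]
    congr 1
    ring
  have hc0 : 0 < c := by
    rw [hc]
    exact Real.cos_pos_of_mem_Ioo ⟨by linarith [Real.pi_pos], by linarith [Real.pi_pos]⟩
  have hs0 : 0 < s := by
    rw [hs]
    exact Real.sin_pos_of_pos_of_lt_pi (by positivity) (by linarith [Real.pi_pos])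
  have hsc : s ^ 2 + c ^ 2 = 1 := by rw [hs, hc]; exact Real.sin_sq_add_cos_sq _
  have hc1 : 0.9396 < c := by
    by_contra h
    rw [not_lt] at h
    nlinarith [mul_nonneg (sub_nonneg.2 h) (mul_self_nonneg c), mul_nonneg (sub_nonneg.2 h) hc0.le]
  have hc2 : c < 0.9398 := by
    by_contra h
    rw [not_lt] at h
    nlinarith [mul_nonneg (sub_nonneg.2 h) (mul_self_nonneg c), mul_nonneg (sub_nonneg.2 h) hc0.le]
  have hs1 : 0.3416 < s := by
    by_contra h
    rw [not_lt] at h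
    nlinarith [mul_nonneg (sub_nonneg.2 h) hs0.le,
      mul_pos (sub_pos.2 hc2) (by linarith : (0 : ℝ) < c + 0.9398)]
  have hs2 : s < 0.3424 := by
    by_contra h
    rw [not_lt] at h
    nlinarith [mul_nonneg (sub_nonneg.2 h) (by linarith : (0 : ℝ) ≤ s + 0.3424),
      mul_pos (sub_pos.2 hc1) (by linarith : (0 : ℝ) < c + 0.9396)]
  have e5 : Real.cos (5 * Real.pi / 18) = 2 * s * c := by
    rw [show 5 * Real.pi / 18 = Real.pi / 2 - 2 * (Real.pi / 9) by ring, Real.cos_pi_div_two_sub,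
      Real.sin_two_mul, hs, hc]
  have e4 : Real.cos (2 * Real.pi / 9) = 2 * c ^ 2 - 1 := by
    rw [show 2 * Real.pi / 9 = 2 * (Real.pi / 9) by ring, Real.cos_two_mul, hc]
  rw [e5, e4, ← hs]
  refine ⟨⟨?_, ?_⟩, ⟨?_, ?_⟩, hs1, hs2⟩
  · nlinarith [mul_nonneg (sub_nonneg.2 hs1.le) (sub_nonneg.2 hc1.le)]
  · nlinarith [mul_nonneg (sub_nonneg.2 hs2.le) (sub_nonneg.2 hc1.le)]
  · nlinarith [mul_pos (sub_pos.2 hc1) (by linarith : (0 : ℝ) < c + 0.9396)]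
  · nlinarith [mul_pos (sub_pos.2 hc2) (by linarith : (0 : ℝ) < c + 0.9398)]

/-- **A `ℤ₂`-symmetric `4 × 4` correlation matrix with non-negative margins is the Gram matrix of
real-algebraic vectors.** For real-algebraic `a, b, c, d` with `|a| < 1`, `(b + c)² ≤ (1 + a)(1 + d)`
and `(b − c)² ≤ (1 − a)(1 − d)` there are `n₀, …, n₃ ∈ ℝ⁴` with real-algebraic coordinates and
`⟨nᵢ, nⱼ⟩ = !![1, a, b, c; a, 1, c, b; b, c, 1, d; c, b, d, 1] i j`: namely `n₀ = (P, 0, Q, 0)`,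
`n₁ = (P, 0, −Q, 0)`, `n₂ = (X, Z, Y, W)`, `n₃ = (X, Z, −Y, −W)` with `P = √((1+a)/2)`,
`Q = √((1−a)/2)`, `X = (b+c)/(2P)`, `Y = (b−c)/(2Q)`, `Z = √((1+d)/2 − X²)`, `W = √((1−d)/2 − Y²)`
(the two hypotheses are exactly the non-negativity of the last two radicands). [folklore] -/
theorem kr_gram_factor {a b c d : ℝ} (ha₁ : -1 < a) (ha₂ : a < 1)
    (h₁ : (b + c) ^ 2 ≤ (1 + a) * (1 + d)) (h₂ : (b - c) ^ 2 ≤ (1 - a) * (1 - d))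
    (hA : IsAlgebraic ℚ a) (hB : IsAlgebraic ℚ b) (hC : IsAlgebraic ℚ c) (hD : IsAlgebraic ℚ d) :
    ∃ n : Fin 4 → Fin 4 → ℝ, (∀ i k, IsAlgebraic ℚ (n i k)) ∧
      ∀ i j, ∑ k, n i k * n j k = !![1, a, b, c; a, 1, c, b; b, c, 1, d; c, b, d, 1] i j := by
  have alg_sqrt := @HyperbolicBloch.OffTetraSectorKernel.redAux_isAlgebraic_sqrt
  have h2 : IsAlgebraic ℚ (2 : ℝ) := by simpa using isAlgebraic_rat ℚ (A := ℝ) 2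
  have hdiv : ∀ {x y : ℝ}, IsAlgebraic ℚ x → IsAlgebraic ℚ y → IsAlgebraic ℚ (x / y) :=
    fun hx hy => by rw [div_eq_mul_inv]; exact hx.mul hy.inv
  -- `P`, `Q`: the first two vectors `(P, 0, ±Q, 0)`
  obtain ⟨P, hP⟩ : ∃ P, P = Real.sqrt ((1 + a) / 2) := ⟨_, rfl⟩
  obtain ⟨Q, hQ⟩ : ∃ Q, Q = Real.sqrt ((1 - a) / 2) := ⟨_, rfl⟩
  have hP0 : 0 < P := by rw [hP]; exact Real.sqrt_pos.2 (by linarith)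
  have hQ0 : 0 < Q := by rw [hQ]; exact Real.sqrt_pos.2 (by linarith)
  have hP2 : P ^ 2 = (1 + a) / 2 := by rw [hP]; exact Real.sq_sqrt (by linarith)
  have hQ2 : Q ^ 2 = (1 - a) / 2 := by rw [hQ]; exact Real.sq_sqrt (by linarith)
  have hPa : IsAlgebraic ℚ P := by
    rw [hP]; exact alg_sqrt (hdiv (isAlgebraic_one.add hA) h2) (by linarith)
  have hQa : IsAlgebraic ℚ Q := by
    rw [hQ]; exact alg_sqrt (hdiv (isAlgebraic_one.sub hA) h2) (by linarith)
  -- `X`, `Y`: forced by `⟨n₀, n₂⟩ = b`, `⟨n₀, n₃⟩ = c`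
  obtain ⟨X, hX⟩ : ∃ X, X = (b + c) / (2 * P) := ⟨_, rfl⟩
  obtain ⟨Y, hY⟩ : ∃ Y, Y = (b - c) / (2 * Q) := ⟨_, rfl⟩
  have hPX : P * X = (b + c) / 2 := by rw [hX]; field_simp
  have hQY : Q * Y = (b - c) / 2 := by rw [hY]; field_simp
  have hXa : IsAlgebraic ℚ X := by rw [hX]; exact hdiv (hB.add hC) (h2.mul hPa)
  have hYa : IsAlgebraic ℚ Y := by rw [hY]; exact hdiv (hB.sub hC) (h2.mul hQa)
  -- the two radicands are the margins divided by `2(1 ± a) > 0`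
  have hX2 : X ^ 2 * (2 * (1 + a)) = (b + c) ^ 2 := by
    have : X ^ 2 * (2 * (1 + a)) = (P * X) ^ 2 * 4 := by rw [mul_pow, hP2]; ring
    rw [this, hPX]; ring
  have hY2 : Y ^ 2 * (2 * (1 - a)) = (b - c) ^ 2 := by
    have : Y ^ 2 * (2 * (1 - a)) = (Q * Y) ^ 2 * 4 := by rw [mul_pow, hQ2]; ring
    rw [this, hQY]; ring
  have h1a : (0 : ℝ) < 1 + a := by linarith
  have h1a' : (0 : ℝ) < 1 - a := by linarith
  have hXr : 0 ≤ (1 + d) / 2 - X ^ 2 := by nlinarith [h1a, hX2, h₁]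
  have hYr : 0 ≤ (1 - d) / 2 - Y ^ 2 := by nlinarith [h1a', hY2, h₂]
  obtain ⟨Z, hZ⟩ : ∃ Z, Z = Real.sqrt ((1 + d) / 2 - X ^ 2) := ⟨_, rfl⟩
  obtain ⟨W, hW⟩ : ∃ W, W = Real.sqrt ((1 - d) / 2 - Y ^ 2) := ⟨_, rfl⟩
  have hZ2 : Z ^ 2 = (1 + d) / 2 - X ^ 2 := by rw [hZ]; exact Real.sq_sqrt hXr
  have hW2 : W ^ 2 = (1 - d) / 2 - Y ^ 2 := by rw [hW]; exact Real.sq_sqrt hYr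
  have hZa : IsAlgebraic ℚ Z := by
    rw [hZ]; exact alg_sqrt ((hdiv (isAlgebraic_one.add hD) h2).sub (hXa.pow 2)) hXr
  have hWa : IsAlgebraic ℚ W := by
    rw [hW]; exact alg_sqrt ((hdiv (isAlgebraic_one.sub hD) h2).sub (hYa.pow 2)) hYr
  refine ⟨![![P, 0, Q, 0], ![P, 0, -Q, 0], ![X, Z, Y, W], ![X, Z, -Y, -W]], ?_, ?_⟩
  · intro i k
    fin_cases i <;> fin_cases k <;> simp <;>
      first
      | exact isAlgebraic_zero
      | assumption
      | (apply IsAlgebraic.neg; assumption)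
  · intro i j
    fin_cases i <;> fin_cases j <;> simp [Fin.sum_univ_four] <;>
      first
      | linear_combination hP2 + hQ2
      | linear_combination hP2 - hQ2
      | linear_combination hPX + hQY
      | linear_combination hPX - hQY
      | linear_combination hZ2 + hW2
      | linear_combination hZ2 - hW2

/-- **The solid sector of the unit ball cut out by real-algebraic normals is `ℚ`-semialgebraic**:
`{v ∈ ℝ⁴ | ⟨nᵢ, v⟩ ≥ 0 (i < 4), |v|² ≤ 1}` is the finite intersection of the sets where the
`ℚ`-semialgebraic functions `v ↦ ∑ₖ nᵢₖ vₖ` (real-algebraic constants are `ℚ`-definable) are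
non-negative on the closed unit ball (graph elimination). [cite: BochnakCosteRoy1998, §2.2] -/
theorem kr_isSemialgebraic_sector {n : Fin 4 → Fin 4 → ℝ} (halg : ∀ i k, IsAlgebraic ℚ (n i k)) :
    IsSemialgebraic ℚ {v : Fin 4 → ℝ | (∀ i, 0 ≤ ∑ k, n i k * v k) ∧ ∑ j, v j ^ 2 ≤ 1} := by
  have hB : IsSemialgebraic ℚ {v : Fin 4 → ℝ | ∑ j, v j ^ 2 ≤ 1} :=
    InverseLandau.RadialBand.isSemialgebraic_closedBall 4
  have hf : ∀ i, IsSemialgebraicFunOn ℚ {v : Fin 4 → ℝ | ∑ j, v j ^ 2 ≤ 1}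
      (fun v => ∑ k, n i k * v k) := fun i =>
    IsSemialgebraicFunOn.fun_finsetSum Finset.univ hB fun k _ =>
      (isSemialgebraicFunOn_const_of_isAlgebraic hB (halg i k)).fun_mul
        (isSemialgebraicFunOn_apply hB k)
  convert IsSemialgebraic.biInter (k := ℚ) (R := ℝ) (Finset.univ : Finset (Fin 4)) _
    fun i _ => (hf i).isSemialgebraic_sep_nonneg using 1
  ext v
  simp only [mem_setOf_eq, mem_iInter, Finset.mem_univ, forall_const]
  exact ⟨fun ⟨h1, h2⟩ i => ⟨h2, h1 i⟩, fun h => ⟨fun i => (h i).2, (h 0).1⟩⟩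

/-- **`KRSectorExists`** (route SphericalSchlafli, stmt-KontsevichZagierPeriods-3821): there are
vectors `n₀, …, n₃ ∈ ℝ⁴` whose Gram matrix is the Kolpakov–Robins matrix
`!![1, −cos(13π/18), −cos(5π/18), −cos(2π/9); −cos(13π/18), 1, −cos(2π/9), −cos(5π/18);
−cos(5π/18), −cos(2π/9), 1, −cos(11π/18); −cos(2π/9), −cos(5π/18), −cos(11π/18), 1]`, together with
an integral representation of the Kontsevich–Zagier calculus whose domain is the solid sector
`{v | ⟨nᵢ, v⟩ ≥ 0 (i < 4), ∑ vⱼ² ≤ 1}` and whose integrand is `1` on it. Proof: the explicit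
`ℤ₂`-symmetric factorisation `kr_gram_factor`, whose two margins `(1 + sin 40°)(1 + sin 20°) ≥
(sin 40° + cos 40°)²` and `(1 − sin 40°)(1 − sin 20°) ≥ (cos 40° − sin 40°)²` follow from the
decimal brackets `kr_trig_bounds`; the coordinates are real-algebraic, so the sector is
`ℚ`-semialgebraic (`kr_isSemialgebraic_sector`), and the constant `1` is integrable on a subset of
the unit ball. [cite: KontsevichZagier2001, §1.1] -/
theorem krSectorExists_proof :
    Summit.KontsevichZagierPeriods.KontsevichZagierPeriods.Theses.SphericalSchlafli.KRSectorExists := by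
  obtain ⟨⟨hA1, hA2⟩, ⟨hC1, hC2⟩, ⟨hD1, hD2⟩⟩ := kr_trig_bounds
  have e13 : Real.cos (13 * Real.pi / 18) = -Real.cos (5 * Real.pi / 18) := by
    rw [show 13 * Real.pi / 18 = Real.pi - 5 * Real.pi / 18 by ring, Real.cos_pi_sub]
  have e11 : Real.cos (11 * Real.pi / 18) = -Real.sin (Real.pi / 9) := by
    rw [show 11 * Real.pi / 18 = Real.pi / 9 + Real.pi / 2 by ring, Real.cos_add_pi_div_two]
  -- the four cosines are real-algebraic
  have halg : ∀ (p q : ℕ), 0 < q → ∀ x : ℝ, x = p * Real.pi / q →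
      IsAlgebraic ℚ (-Real.cos x) := fun p q hq x hx => by
    have e : Real.pi * p / q = x := by rw [hx]; ring
    exact (e ▸ KoblitzOgus.isAlgebraic_cos_rat_mul_pi p hq).neg
  -- upper bounds used by `nlinarith`
  have hAC : Real.cos (5 * Real.pi / 18) + Real.cos (2 * Real.pi / 9) ≤ 1.4101 := by linarith
  have hCA : Real.cos (2 * Real.pi / 9) - Real.cos (5 * Real.pi / 18) ≤ 0.1246 := by linarith
  obtain ⟨n, hnalg, hn⟩ := kr_gram_factor (a := -Real.cos (13 * Real.pi / 18))
    (b := -Real.cos (5 * Real.pi / 18)) (c := -Real.cos (2 * Real.pi / 9))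
    (d := -Real.cos (11 * Real.pi / 18))
    (by rw [e13]; linarith) (by rw [e13]; linarith)
    (by
      rw [e13, e11]
      nlinarith [mul_nonneg (sub_nonneg.2 hA1.le) (sub_nonneg.2 hD1.le),
        mul_nonneg (sub_nonneg.2 hAC)
          (by linarith : (0 : ℝ) ≤ Real.cos (5 * Real.pi / 18) + Real.cos (2 * Real.pi / 9))])
    (by
      rw [e13, e11]
      nlinarith [mul_nonneg (sub_nonneg.2 hA2.le) (sub_nonneg.2 hD2.le),
        mul_nonneg (sub_nonneg.2 hCA)
          (by linarith : (0 : ℝ) ≤ Real.cos (2 * Real.pi / 9) - Real.cos (5 * Real.pi / 18))])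
    (halg 13 18 (by norm_num) _ (by push_cast; ring)) (halg 5 18 (by norm_num) _ (by push_cast; ring))
    (halg 2 9 (by norm_num) _ (by push_cast; ring)) (halg 11 18 (by norm_num) _ (by push_cast; ring))
  have hS := kr_isSemialgebraic_sector hnalg
  -- the sector lies in the closed unit ball of the sup norm, of finite volume
  have hsub : {v : Fin 4 → ℝ | (∀ i, 0 ≤ ∑ k, n i k * v k) ∧ ∑ j, v j ^ 2 ≤ 1} ⊆
      Metric.closedBall (0 : Fin 4 → ℝ) 1 := fun v hv => by
    rw [mem_closedBall_zero_iff, pi_norm_le_iff_of_nonneg zero_le_one]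
    intro j
    rw [Real.norm_eq_abs, ← sq_le_one_iff_abs_le_one]
    exact (Finset.single_le_sum (fun i _ => sq_nonneg (v i)) (Finset.mem_univ j)).trans hv.2
  exact ⟨n, hn, ⟨{v | (∀ i, 0 ≤ ∑ k, n i k * v k) ∧ ∑ j, v j ^ 2 ≤ 1}, fun _ => 1, hS,
    isSemialgebraicFunOn_const_of_isAlgebraic hS isAlgebraic_one,
    integrableOn_const (ne_top_of_le_ne_top measure_closedBall_lt_top.ne (measure_mono hsub))⟩,
    rfl, fun _ _ => rfl⟩

end Summit.KontsevichZagierPeriods.SphericalSchlafli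

end
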